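import Mathlib.LinearAlgebra.FiniteDimensional.Lemmas
import Mathlib.LinearAlgebra.Quotient.Basic
import Mathlib.RingTheory.Finiteness.Basic
import Mathlib.Algebra.BigOperators.Group.Finset.Basic
import HarnessLib

/-!
# Dimension of the cohomology of a finitely filtered complex (the Frölicher inequality, algebraic part)

Elementary linear algebra behind the inequality `b_k ≤ ∑_{p+q=k} h^{p,q}` (Frölicher 1955) for a
compact complex manifold, in the form printed in C. Voisin, *Hodge Theory and Complex Algebraic
Geometry I* (2002), §8.3.3, proof of Thm. 8.28 and Rem. 8.29, pp. 204–205: for the spectral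
sequence of the de Rham complex filtered by `F^p A^k = ⨁_{r ≥ p} A^{r,k-r}`, "`E_∞^{p,q} =
F^pH^k/F^{p+1}H^k` can be identified with a quotient of a subspace of `E_1^{p,q}`", whence
`dim H^k = ∑_p dim E_∞^{p,k-p} ≤ ∑_p dim E_1^{p,k-p}`.

We avoid spectral sequences altogether and prove the inequality for three consecutive terms
`A₀ → A₁ → A₂` (degrees `k-1, k, k+1`) of a complex of modules over a division ring `K` carrying
decreasing `ℕ`-indexed filtrations `F^p`:

* `Literature.Algebra.Homology.FilteredTriple.finite_and_finrank_cohomology_le`: if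
  `F^0 = ⊤` (degrees `k-1`, `k`), `F^{N+1} A₁ = ⊥`, and the graded pieces
  `H^k(Gr^p) = {x ∈ F^pA₁ | d x ∈ F^{p+1}A₂} / (d(F^pA₀) + F^{p+1}A₁)` are finite-dimensional for
  `p ≤ N`, then `H^k = ker d₁ / im d₀` is finite-dimensional and
  `dim H^k ≤ ∑_{p=0}^{N} dim H^k(Gr^p)`. Proof: the sequence
  `H^k(F^{p+1}) → H^k(F^p) → H^k(Gr^p)` is exact in the middle (a piece of the long exact
  sequence of `0 → F^{p+1} → F^p → Gr^p → 0`), so `dim H^k(F^p) ≤ dim H^k(F^{p+1}) + dim H^k(Gr^p)`;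
  induct downwards from `F^{N+1} = 0`. (No compatibility `d F^p ⊆ F^p` is needed for the
  inequality; it holds in every application.)
* `Literature.Algebra.Homology.BigradedTriple.finite_and_finrank_cohomology_le_sum`: the
  bigraded form used for the Dolbeault double complex. The modules carry "type projections"
  `π p` (`p` = first degree) with `∑_{p ≤ N} π p = id` on `A₁`, and `d` of an element of pure
  type `p` has only types `p` and `p + 1` (`d = ∂ + ∂̄`). With `F^p = ⋂_{r<p} ker (π r)` the
  graded piece `H^k(Gr^p)` has dimension at most that of the "`∂̄`-cohomology in type `p`"
  `pureCohomology p = {x | π p x = x, π p (d x) = 0} / {π p (d y) | π p y = y}` (i.e.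
  `E_1^{p,k-p} = H^{k-p}(A^{p,•}, ∂̄)`, Voisin (2002), Prop. 8.25): the leading-component map
  `z ↦ π p z` on cocycles of `Gr^p` kills only coboundaries, so `H^k(Gr^p)` is a quotient of a
  subspace of `pureCohomology p`; hence `dim H^k ≤ ∑_{p=0}^{N} dim (pureCohomology p)`.
* `Literature.Algebra.Homology.nonempty_subquotient_equiv`: transport of sub-quotients
  `↥Z ⧸ B.comap Z.subtype` along a linear map, used by consumers to identify `ker d₁ / im d₀` and
  `pureCohomology p` with concretely defined cohomology groups.

Consumer: `Literature/AlgebraicGeometry/Motives/DeRhamComparison` (Frölicher inequality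
`finrank_complexDeRham_le_sum_hodgeNumber`, hodge.S18).

## Mathlib status (pin v4.32.0)

Mathlib has spectral objects / spectral sequences (`Mathlib.Algebra.Homology.SpectralObject`)
but not the comparison `E_∞` = graded pieces of the abutment for a filtered complex, nor any
dimension count; the elementary argument here needs only `Submodule.mapQ`, rank–nullity
(`LinearMap.finrank_range_add_finrank_ker`) and `Submodule.fg_of_fg_map_of_fg_inf_ker`.
Sub-quotients are written `↥Z ⧸ B.comap Z.subtype` throughout, as in the consumer files.

## References

* A. Frölicher, *Relations between the cohomology groups of Dolbeault and topological
  invariants*, Proc. Nat. Acad. Sci. USA 41 (1955), 641–644, §2.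
* C. Voisin, *Hodge Theory and Complex Algebraic Geometry I* (2002), §8.3.1–8.3.2 (filtered
  complexes, Thm. 8.21, Prop. 8.25), §8.3.3 (Rem. 8.27, Thm. 8.28, Rem. 8.29), pp. 200–205
  (`VoisinHodgeI2002`).
-/

open Module Finset

namespace Literature.Algebra.Homology

universe u v₀ v₁ v₂ w

variable {K : Type u} [DivisionRing K]

/-! ### Sub-quotients: two transfer lemmas -/

section Subquotient

variable {V : Type v₁} [AddCommGroup V] [Module K V] {W : Type v₂} [AddCommGroup W] [Module K W]

/-- If a linear map `ψ` from `Z` to a finite-dimensional space kills only elements of `B`, then the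
sub-quotient `Z/(B ∩ Z)` is finite-dimensional of dimension at most `dim` of the target
(`Z/(B ∩ Z)` is a quotient of `Z / ker ψ ≅ im ψ`). [folklore] -/
theorem finite_and_finrank_subquotient_le {H : Type v₀} [AddCommGroup H] [Module K H]
    [FiniteDimensional K H] (Z B : Submodule K V) (ψ : ↥Z →ₗ[K] H)
    (hψ : ∀ z : ↥Z, ψ z = 0 → (z : V) ∈ B) :
    FiniteDimensional K (↥Z ⧸ B.comap Z.subtype) ∧
      finrank K (↥Z ⧸ B.comap Z.subtype) ≤ finrank K H := by
  have hker : LinearMap.ker ψ ≤ B.comap Z.subtype := fun z hz ↦ hψ z hz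
  haveI : FiniteDimensional K (↥Z ⧸ LinearMap.ker ψ) :=
    LinearEquiv.finiteDimensional ψ.quotKerEquivRange.symm
  let e := Submodule.quotientQuotientEquivQuotient (LinearMap.ker ψ) (B.comap Z.subtype) hker
  refine ⟨LinearEquiv.finiteDimensional e, ?_⟩
  calc finrank K (↥Z ⧸ B.comap Z.subtype)
      = finrank K ((↥Z ⧸ LinearMap.ker ψ) ⧸
          (B.comap Z.subtype).map (LinearMap.ker ψ).mkQ) := (LinearEquiv.finrank_eq e).symm
    _ ≤ finrank K (↥Z ⧸ LinearMap.ker ψ) := Submodule.finrank_quotient_le _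
    _ = finrank K (LinearMap.range ψ) := LinearEquiv.finrank_eq ψ.quotKerEquivRange
    _ ≤ finrank K H := Submodule.finrank_le _

omit [DivisionRing K] in
/-- Transport of sub-quotients along a linear map: if `e` maps `Z` onto `Z'` and, on `Z`,
membership of the image in `B'` is membership in `B`, then `Z/(B ∩ Z) ≃ Z'/(B' ∩ Z')`
(first isomorphism theorem). Stated over any ring. [folklore] -/
theorem nonempty_subquotient_equiv {R : Type u} [Ring R] [Module R V] [Module R W]
    (e : V →ₗ[R] W) (Z B : Submodule R V) (Z' B' : Submodule R W)
    (hZ : Z.map e = Z') (hB : ∀ z ∈ Z, e z ∈ B' ↔ z ∈ B) :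
    Nonempty ((↥Z ⧸ B.comap Z.subtype) ≃ₗ[R] (↥Z' ⧸ B'.comap Z'.subtype)) := by
  have hZle : ∀ z ∈ Z, e z ∈ Z' := fun z hz ↦ hZ ▸ Submodule.mem_map_of_mem hz
  let φ : ↥Z →ₗ[R] ↥Z' := e.restrict (p := Z) (q := Z') fun z hz ↦ hZle z hz
  let g : ↥Z →ₗ[R] (↥Z' ⧸ B'.comap Z'.subtype) := (B'.comap Z'.subtype).mkQ ∘ₗ φ
  have hg : Function.Surjective g := by
    intro q
    obtain ⟨z', rfl⟩ := Submodule.Quotient.mk_surjective _ q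
    have hz' : (z' : W) ∈ Z.map e := hZ ▸ z'.2
    obtain ⟨z, hz, hzz'⟩ := Submodule.mem_map.1 hz'
    refine ⟨⟨z, hz⟩, ?_⟩
    change Submodule.Quotient.mk (φ ⟨z, hz⟩) = Submodule.Quotient.mk z'
    congr 1
    exact Subtype.ext hzz'
  have hker : LinearMap.ker g = B.comap Z.subtype := by
    ext z
    rw [LinearMap.mem_ker, Submodule.mem_comap, Submodule.subtype_apply]
    change Submodule.Quotient.mk (φ z) = (0 : ↥Z' ⧸ B'.comap Z'.subtype) ↔ _
    rw [Submodule.Quotient.mk_eq_zero, Submodule.mem_comap, Submodule.subtype_apply]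
    exact hB z z.2
  exact ⟨(Submodule.quotEquivOfEq _ _ hker.symm).trans (g.quotKerEquivOfSurjective hg)⟩

end Subquotient

/-! ### Filtered three-term complexes -/

section

variable (K)
variable (A₀ : Type v₀) (A₁ : Type v₁) (A₂ : Type v₂)
  [AddCommGroup A₀] [Module K A₀] [AddCommGroup A₁] [Module K A₁] [AddCommGroup A₂] [Module K A₂]

/-- Three consecutive terms `A₀ -d₀→ A₁ -d₁→ A₂` (`d₁ ∘ d₀ = 0`) of a cochain complex of
`K`-modules with `ℕ`-indexed filtrations `F^p`: decreasing and exhaustive (`F^0 = ⊤`) in the two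
lower degrees, arbitrary in the upper degree (`F₂` only enters the definition of the cocycles of
`Gr^p`, `grCocycles`). This is all the structure of a filtered complex `(K^•, F)` (Voisin (2002),
§8.3.1) that the dimension count in one degree uses; the compatibilities `d(F^p) ⊆ F^p` and the
remaining filtration axioms are not recorded because the count below holds without them.
[cite: VoisinHodgeI2002, §8.3.1] -/
structure FilteredTriple where
  /-- the differential into the middle degree -/
  d₀ : A₀ →ₗ[K] A₁
  /-- the differential out of the middle degree -/
  d₁ : A₁ →ₗ[K] A₂
  /-- the filtration in the lower degree -/
  F₀ : ℕ → Submodule K A₀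
  /-- the filtration in the middle degree -/
  F₁ : ℕ → Submodule K A₁
  /-- the filtration in the upper degree -/
  F₂ : ℕ → Submodule K A₂
  d₁_d₀ : ∀ x, d₁ (d₀ x) = 0
  antitone_F₀ : Antitone F₀
  antitone_F₁ : Antitone F₁
  F₀_zero : F₀ 0 = ⊤
  F₁_zero : F₁ 0 = ⊤

end

namespace FilteredTriple

variable {A₀ : Type v₀} {A₁ : Type v₁} {A₂ : Type v₂}
  [AddCommGroup A₀] [Module K A₀] [AddCommGroup A₁] [Module K A₁] [AddCommGroup A₂] [Module K A₂]
  (C : FilteredTriple K A₀ A₁ A₂)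

/-- The cohomology `H = ker d₁ / im d₀` in the middle degree (as a sub-quotient of `A₁`).
[cite: VoisinHodgeI2002, §8.3.1] -/
abbrev cohomology : Type v₁ :=
  ↥(LinearMap.ker C.d₁) ⧸ (LinearMap.range C.d₀).comap (LinearMap.ker C.d₁).subtype

/-- Cocycles of the subcomplex `F^p`: `F^pA₁ ∩ ker d₁`. [cite: VoisinHodgeI2002, §8.3.1] -/
def filtCocycles (p : ℕ) : Submodule K A₁ := C.F₁ p ⊓ LinearMap.ker C.d₁

/-- Coboundaries of the subcomplex `F^p`: `d₀(F^pA₀)`. [cite: VoisinHodgeI2002, §8.3.1] -/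
def filtCoboundaries (p : ℕ) : Submodule K A₁ := (C.F₀ p).map C.d₀

/-- The cohomology `H(F^p) = (F^pA₁ ∩ ker d₁) / d₀(F^pA₀)` of the subcomplex `F^p` in the middle
degree; its image in `H` is `F^pH` (Voisin (2002), Def. 8.20 and proof of Thm. 8.21 (iii)).
[cite: VoisinHodgeI2002, §8.3.2, proof of Thm. 8.21] -/
abbrev filtCohomology (p : ℕ) : Type v₁ :=
  ↥(C.filtCocycles p) ⧸ (C.filtCoboundaries p).comap (C.filtCocycles p).subtype

/-- Cocycles of the graded complex `Gr^p = F^p/F^{p+1}` in the middle degree, lifted to `A₁`: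
`{x ∈ F^pA₁ | d₁ x ∈ F^{p+1}A₂}` (`Z_1^{p,k-p}` in Voisin (2002), proof of Thm. 8.21, p. 202).
[cite: VoisinHodgeI2002, §8.3.2, proof of Thm. 8.21] -/
def grCocycles (p : ℕ) : Submodule K A₁ := C.F₁ p ⊓ (C.F₂ (p + 1)).comap C.d₁

/-- Coboundaries of `Gr^p` in the middle degree, lifted to `A₁`: `d₀(F^pA₀) + F^{p+1}A₁`.
[cite: VoisinHodgeI2002, §8.3.2, proof of Thm. 8.21] -/
def grCoboundaries (p : ℕ) : Submodule K A₁ := (C.F₀ p).map C.d₀ ⊔ C.F₁ (p + 1)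

/-- The cohomology `H(Gr^p)` of the graded complex in the middle degree (`= E_1^{p,k-p}`,
Voisin (2002), proof of Thm. 8.21 with `r = 1`, and Prop. 8.25). [cite: VoisinHodgeI2002, §8.3.2, proof of Thm. 8.21] -/
abbrev grCohomology (p : ℕ) : Type v₁ :=
  ↥(C.grCocycles p) ⧸ (C.grCoboundaries p).comap (C.grCocycles p).subtype

/-- Membership in `filtCocycles` (unfolding). [folklore] -/
theorem mem_filtCocycles {p : ℕ} {x : A₁} : x ∈ C.filtCocycles p ↔ x ∈ C.F₁ p ∧ C.d₁ x = 0 := by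
  rw [filtCocycles, Submodule.mem_inf, LinearMap.mem_ker]

/-- Membership in `grCocycles` (unfolding). [folklore] -/
theorem mem_grCocycles {p : ℕ} {x : A₁} :
    x ∈ C.grCocycles p ↔ x ∈ C.F₁ p ∧ C.d₁ x ∈ C.F₂ (p + 1) := by
  rw [grCocycles, Submodule.mem_inf, Submodule.mem_comap]

/-- `F^{p+1} ∩ ker d₁ ⊆ F^p ∩ ker d₁`. [folklore] -/
theorem filtCocycles_le_succ (p : ℕ) : C.filtCocycles (p + 1) ≤ C.filtCocycles p :=
  inf_le_inf_right _ (C.antitone_F₁ (Nat.le_succ p))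

/-- Cocycles of `F^p` are cocycles of `Gr^p`. [folklore] -/
theorem filtCocycles_le_grCocycles (p : ℕ) : C.filtCocycles p ≤ C.grCocycles p := by
  intro x hx
  rw [mem_filtCocycles] at hx
  rw [mem_grCocycles, hx.2]
  exact ⟨hx.1, Submodule.zero_mem _⟩

/-- The map `H(F^{p+1}) → H(F^p)` induced by the inclusion `F^{p+1} ⊆ F^p`.
[cite: VoisinHodgeI2002, §8.3.1] -/
def filtCohomologyMap (p : ℕ) : C.filtCohomology (p + 1) →ₗ[K] C.filtCohomology p :=
  Submodule.mapQ _ _ (Submodule.inclusion (C.filtCocycles_le_succ p)) fun x hx ↦ by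
    rw [Submodule.mem_comap, Submodule.mem_comap, Submodule.subtype_apply,
      Submodule.coe_inclusion]
    exact Submodule.map_mono (C.antitone_F₀ (Nat.le_succ p)) hx

/-- The map `H(F^p) → H(Gr^p)` induced by the projection `F^p → Gr^p`.
[cite: VoisinHodgeI2002, §8.3.1] -/
def filtToGrCohomology (p : ℕ) : C.filtCohomology p →ₗ[K] C.grCohomology p :=
  Submodule.mapQ _ _ (Submodule.inclusion (C.filtCocycles_le_grCocycles p)) fun x hx ↦ by
    rw [Submodule.mem_comap, Submodule.mem_comap, Submodule.subtype_apply,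
      Submodule.coe_inclusion]
    exact Submodule.mem_sup_left hx

/-- Exactness of `H(F^{p+1}) → H(F^p) → H(Gr^p)` at the middle term (part of the long exact
sequence of `0 → F^{p+1} → F^p → Gr^p → 0`). [cite: VoisinHodgeI2002, §8.3.1] -/
theorem ker_filtToGrCohomology_le (p : ℕ) :
    LinearMap.ker (C.filtToGrCohomology p) ≤ LinearMap.range (C.filtCohomologyMap p) := by
  intro q hq
  obtain ⟨x, rfl⟩ := Submodule.Quotient.mk_surjective _ q
  have hx := (C.mem_filtCocycles).1 x.2
  rw [LinearMap.mem_ker, filtToGrCohomology, Submodule.mapQ_apply, Submodule.Quotient.mk_eq_zero,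
    Submodule.mem_comap, Submodule.subtype_apply, Submodule.coe_inclusion, grCoboundaries,
    Submodule.mem_sup] at hq
  obtain ⟨u, hu, v, hv, huv⟩ := hq
  obtain ⟨y, hy, rfl⟩ := Submodule.mem_map.1 hu
  have hv' : v ∈ C.filtCocycles (p + 1) := by
    rw [mem_filtCocycles]
    refine ⟨hv, ?_⟩
    have : v = (x : A₁) - C.d₀ y := by rw [← huv]; abel
    rw [this, map_sub, hx.2, C.d₁_d₀, sub_zero]
  refine ⟨Submodule.Quotient.mk ⟨v, hv'⟩, ?_⟩
  rw [filtCohomologyMap, Submodule.mapQ_apply, Submodule.Quotient.eq, Submodule.mem_comap,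
    Submodule.subtype_apply]
  change (v : A₁) - x ∈ C.filtCoboundaries p
  have : (v : A₁) - x = C.d₀ (-y) := by rw [map_neg, ← huv]; abel
  rw [this]
  exact Submodule.mem_map_of_mem (Submodule.neg_mem _ hy)

/-- One step of the count: `dim H(F^p) ≤ dim H(F^{p+1}) + dim H(Gr^p)`, with finiteness
propagating (Voisin (2002), proof of Thm. 8.28: "`E_∞^{p,q}` is a quotient of a subspace of
`E_1^{p,q}`"). [cite: VoisinHodgeI2002, §8.3.3, proof of Thm. 8.28] -/
theorem finite_and_finrank_filtCohomology_le (p : ℕ)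
    (h₁ : FiniteDimensional K (C.filtCohomology (p + 1)))
    (h₂ : FiniteDimensional K (C.grCohomology p)) :
    FiniteDimensional K (C.filtCohomology p) ∧
      finrank K (C.filtCohomology p) ≤
        finrank K (C.filtCohomology (p + 1)) + finrank K (C.grCohomology p) := by
  set ρ := C.filtToGrCohomology p
  set ι := C.filtCohomologyMap p
  have hexact : LinearMap.ker ρ ≤ LinearMap.range ι := C.ker_filtToGrCohomology_le p
  haveI : FiniteDimensional K ↥(LinearMap.range ι) := inferInstance
  haveI hkerfin : FiniteDimensional K ↥(LinearMap.ker ρ) :=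
    Submodule.finiteDimensional_of_le hexact
  have hfin : FiniteDimensional K (C.filtCohomology p) := by
    rw [FiniteDimensional, Module.finite_def]
    refine Submodule.fg_of_fg_map_of_fg_inf_ker ρ ?_ ?_
    · rw [Submodule.map_top]
      exact Module.Finite.iff_fg.1 inferInstance
    · rw [top_inf_eq]
      exact Module.Finite.iff_fg.1 hkerfin
  refine ⟨hfin, ?_⟩
  haveI := hfin
  calc finrank K (C.filtCohomology p)
      = finrank K ↥(LinearMap.range ρ) + finrank K ↥(LinearMap.ker ρ) :=
        (LinearMap.finrank_range_add_finrank_ker ρ).symm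
    _ ≤ finrank K (C.grCohomology p) + finrank K ↥(LinearMap.range ι) :=
        Nat.add_le_add (Submodule.finrank_le _) (Submodule.finrank_mono hexact)
    _ ≤ finrank K (C.grCohomology p) + finrank K (C.filtCohomology (p + 1)) :=
        Nat.add_le_add_left (LinearMap.finrank_range_le ι) _
    _ = _ := Nat.add_comm _ _

/-- If `F^pA₁ = 0` then `H(F^p) = 0` is finite-dimensional of dimension `0`. [folklore] -/
theorem finite_and_finrank_filtCohomology_of_eq_bot {p : ℕ} (h : C.F₁ p = ⊥) :
    FiniteDimensional K (C.filtCohomology p) ∧ finrank K (C.filtCohomology p) = 0 := by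
  have hZ : C.filtCocycles p = ⊥ := by
    rw [filtCocycles, h, bot_inf_eq]
  haveI : Subsingleton ↥(C.filtCocycles p) := by
    rw [hZ]
    infer_instance
  haveI : Subsingleton (C.filtCohomology p) :=
    (Submodule.Quotient.mk_surjective _).subsingleton
  exact ⟨inferInstance, Module.finrank_zero_of_subsingleton⟩

/-- **Dimension count for a finitely filtered complex** (the algebraic content of the Frölicher
inequality, Voisin (2002), §8.3.3, proof of Thm. 8.28 and Rem. 8.29, pp. 204–205): if
`F^{N+1}A₁ = 0` and the graded cohomologies `H(Gr^p)`, `p ≤ N`, are finite-dimensional, then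
`H = ker d₁ / im d₀` is finite-dimensional and `dim H ≤ ∑_{p=0}^{N} dim H(Gr^p)`.
[cite: VoisinHodgeI2002, §8.3.3, proof of Thm. 8.28 and Rem. 8.29] -/
theorem finite_and_finrank_cohomology_le (N : ℕ) (hN : C.F₁ (N + 1) = ⊥)
    (hfin : ∀ p ≤ N, FiniteDimensional K (C.grCohomology p)) :
    FiniteDimensional K C.cohomology ∧
      finrank K C.cohomology ≤ ∑ p ∈ range (N + 1), finrank K (C.grCohomology p) := by
  -- downward induction on `p`, in the form `∀ m p, p + m = N + 1 → …`
  have key : ∀ m p, p + m = N + 1 →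
      FiniteDimensional K (C.filtCohomology p) ∧
        finrank K (C.filtCohomology p) ≤ ∑ r ∈ Ico p (N + 1), finrank K (C.grCohomology r) := by
    intro m
    induction m with
    | zero =>
      intro p hp
      rw [add_zero] at hp
      subst hp
      obtain ⟨h1, h2⟩ := C.finite_and_finrank_filtCohomology_of_eq_bot hN
      exact ⟨h1, h2 ▸ Nat.zero_le _⟩
    | succ m ih =>
      intro p hp
      have hp' : p + 1 + m = N + 1 := by omega
      have hpN : p ≤ N := by omega
      obtain ⟨ih1, ih2⟩ := ih (p + 1) hp'
      obtain ⟨h1, h2⟩ := C.finite_and_finrank_filtCohomology_le p ih1 (hfin p hpN)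
      refine ⟨h1, h2.trans ?_⟩
      rw [Finset.sum_eq_sum_Ico_succ_bot (show p < N + 1 by omega), Nat.add_comm]
      exact Nat.add_le_add_left ih2 _
  obtain ⟨h1, h2⟩ := key (N + 1) 0 (zero_add _)
  haveI := h1
  -- compare `H` with `H(F^0)`
  have h0 := finite_and_finrank_subquotient_le (K := K) (LinearMap.ker C.d₁) (LinearMap.range C.d₀)
    (((C.filtCoboundaries 0).comap (C.filtCocycles 0).subtype).mkQ ∘ₗ
      Submodule.inclusion (p := LinearMap.ker C.d₁) (p' := C.filtCocycles 0) (by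
        rw [filtCocycles, C.F₁_zero, top_inf_eq]))
    (by
      intro z hz
      rw [LinearMap.comp_apply, Submodule.mkQ_apply, Submodule.Quotient.mk_eq_zero,
        Submodule.mem_comap, Submodule.subtype_apply, Submodule.coe_inclusion,
        filtCoboundaries, C.F₀_zero, Submodule.map_top] at hz
      exact hz)
  refine ⟨h0.1, h0.2.trans ?_⟩
  rwa [Finset.range_eq_Ico]

end FilteredTriple

/-! ### Bigraded form: type projections and the `∂̄`-cohomology in pure type -/

section

variable {A : Type v₁} [AddCommGroup A] [Module K A]

/-- The decreasing filtration `F^p = {x | π r x = 0 for all r < p} = ⨁_{r ≥ p} A^{r,•}` defined by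
a family of "type projections" `π r` (Voisin (2002), §8.3.3: `F^pA^k = ⨁_{r ≥ p, r+s=k} A^{r,s}`).
[cite: VoisinHodgeI2002, §8.3.3] -/
def typeFiltration (π : ℕ → A →ₗ[K] A) (p : ℕ) : Submodule K A where
  carrier := {x | ∀ r < p, π r x = 0}
  add_mem' {x y} hx hy r hr := by rw [map_add, hx r hr, hy r hr, add_zero]
  zero_mem' r _ := map_zero _
  smul_mem' c {x} hx r hr := by rw [map_smul, hx r hr, smul_zero]

variable {π : ℕ → A →ₗ[K] A}

/-- Membership in `typeFiltration` (unfolding). [folklore] -/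
@[simp]
theorem mem_typeFiltration {p : ℕ} {x : A} : x ∈ typeFiltration π p ↔ ∀ r < p, π r x = 0 :=
  Iff.rfl

/-- The type filtration is decreasing. [folklore] -/
theorem typeFiltration_antitone : Antitone (typeFiltration π) :=
  fun _ _ hpq _ hx r hr ↦ hx r (lt_of_lt_of_le hr hpq)

/-- `F^0 = ⊤`. [folklore] -/
theorem typeFiltration_zero : typeFiltration π 0 = ⊤ :=
  eq_top_iff.2 fun _ _ r hr ↦ absurd hr (Nat.not_lt_zero r)

end

section

variable (K)
variable (A₀ : Type v₀) (A₁ : Type v₁) (A₂ : Type v₂)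
  [AddCommGroup A₀] [Module K A₀] [AddCommGroup A₁] [Module K A₁] [AddCommGroup A₂] [Module K A₂]

/-- Three consecutive total-degree terms `A₀ -d₀→ A₁ -d₁→ A₂` of (the total complex of) a double
complex, presented through "type projections" `πⱼ p` onto the summands of first degree `p`
(so `A₁ = ⨁_{p ≤ N} A^{p,k-p}` is `∑_{p ≤ N} π₁ p = id` with `π₁ p` idempotent), and the
condition `d = ∂ + ∂̄`: the differential of an element of pure type `p` has components of types
`p` and `p + 1` only. This is the shape of the de Rham complex of a complex manifold with its
`(p,q)`-type decomposition (Voisin (2002), §2.3.3 and §8.3.3); only the axioms used by the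
dimension count are recorded (in particular no exhaustivity in degrees `k ± 1`).
[cite: VoisinHodgeI2002, §8.3.3] -/
structure BigradedTriple where
  /-- the differential into the middle degree -/
  d₀ : A₀ →ₗ[K] A₁
  /-- the differential out of the middle degree -/
  d₁ : A₁ →ₗ[K] A₂
  /-- type projections in the lower degree -/
  π₀ : ℕ → A₀ →ₗ[K] A₀
  /-- type projections in the middle degree -/
  π₁ : ℕ → A₁ →ₗ[K] A₁
  /-- type projections in the upper degree -/
  π₂ : ℕ → A₂ →ₗ[K] A₂
  /-- the largest first degree occurring in the middle degree -/
  N : ℕ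
  d₁_d₀ : ∀ x, d₁ (d₀ x) = 0
  sum_π₁ : ∀ x, ∑ p ∈ Finset.range (N + 1), π₁ p x = x
  π₀_π₀_of_ne : ∀ {r p : ℕ}, r ≠ p → ∀ y, π₀ r (π₀ p y) = 0
  π₁_π₁_self : ∀ p x, π₁ p (π₁ p x) = π₁ p x
  π₁_d₀_π₀ : ∀ {r p : ℕ}, r ≠ p → r ≠ p + 1 → ∀ y, π₁ r (d₀ (π₀ p y)) = 0
  π₂_d₁_π₁ : ∀ {r p : ℕ}, r ≠ p → r ≠ p + 1 → ∀ x, π₂ r (d₁ (π₁ p x)) = 0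

end

namespace BigradedTriple

variable {A₀ : Type v₀} {A₁ : Type v₁} {A₂ : Type v₂}
  [AddCommGroup A₀] [Module K A₀] [AddCommGroup A₁] [Module K A₁] [AddCommGroup A₂] [Module K A₂]
  (B : BigradedTriple K A₀ A₁ A₂)

/-- The filtered triple `F^p = ⨁_{r ≥ p} A^{r,•}` underlying a bigraded triple (Voisin (2002),
§8.3.3, the filtration defining the Frölicher spectral sequence). [cite: VoisinHodgeI2002, §8.3.3] -/
def toFilteredTriple : FilteredTriple K A₀ A₁ A₂ where
  d₀ := B.d₀
  d₁ := B.d₁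
  F₀ := typeFiltration B.π₀
  F₁ := typeFiltration B.π₁
  F₂ := typeFiltration B.π₂
  d₁_d₀ := B.d₁_d₀
  antitone_F₀ := typeFiltration_antitone
  antitone_F₁ := typeFiltration_antitone
  F₀_zero := typeFiltration_zero
  F₁_zero := typeFiltration_zero

/-- The cohomology `H = ker d₁ / im d₀` in the middle degree. [cite: VoisinHodgeI2002, §8.3.1] -/
abbrev cohomology : Type v₁ := B.toFilteredTriple.cohomology

/-- The `∂̄`-closed elements of pure type `p` in the middle degree:
`{x | π₁ p x = x, π₂ p (d₁ x) = 0}` (for `x` of pure type `p`, `π₂ p (d₁ x)` is `∂̄ x`).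
[cite: VoisinHodgeI2002, §8.3.3, Prop. 8.25] -/
def pureClosed (p : ℕ) : Submodule K A₁ where
  carrier := {x | B.π₁ p x = x ∧ B.π₂ p (B.d₁ x) = 0}
  add_mem' {x y} hx hy := ⟨by rw [map_add, hx.1, hy.1], by rw [map_add, map_add, hx.2, hy.2, add_zero]⟩
  zero_mem' := ⟨map_zero _, by rw [map_zero, map_zero]⟩
  smul_mem' c {x} hx := ⟨by rw [map_smul, hx.1], by rw [map_smul, map_smul, hx.2, smul_zero]⟩

/-- Membership in `pureClosed` (unfolding). [folklore] -/
theorem mem_pureClosed {p : ℕ} {x : A₁} :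
    x ∈ B.pureClosed p ↔ B.π₁ p x = x ∧ B.π₂ p (B.d₁ x) = 0 :=
  Iff.rfl

/-- The `∂̄`-exact elements of pure type `p` in the middle degree: `{π₁ p (d₀ y) | y = π₀ p y}`,
i.e. the range of `π₁ p ∘ d₀ ∘ π₀ p`. [cite: VoisinHodgeI2002, §8.3.3, Prop. 8.25] -/
def pureExact (p : ℕ) : Submodule K A₁ := LinearMap.range (B.π₁ p ∘ₗ B.d₀ ∘ₗ B.π₀ p)

/-- Membership in `pureExact` (unfolding). [folklore] -/
theorem mem_pureExact {p : ℕ} {x : A₁} :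
    x ∈ B.pureExact p ↔ ∃ y, B.π₁ p (B.d₀ (B.π₀ p y)) = x := by
  simp [pureExact]

/-- The `∂̄`-cohomology in pure type `p` of the middle degree (`E_1^{p,k-p} = H^{k-p}(A^{p,•}, ∂̄)`,
Voisin (2002), Prop. 8.25), as a sub-quotient of `A₁`. [cite: VoisinHodgeI2002, §8.3.3, Prop. 8.25] -/
abbrev pureCohomology (p : ℕ) : Type v₁ :=
  ↥(B.pureClosed p) ⧸ (B.pureExact p).comap (B.pureClosed p).subtype

/-- The type filtration of the middle degree is finite: `F^{N+1}A₁ = 0` (from `∑_{p ≤ N} π₁ p = id`).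
[folklore] -/
theorem F₁_succ_N_eq_bot : B.toFilteredTriple.F₁ (B.N + 1) = ⊥ := by
  rw [eq_bot_iff]
  intro x hx
  rw [Submodule.mem_bot, ← B.sum_π₁ x]
  exact Finset.sum_eq_zero fun r hr ↦ hx r (Finset.mem_range.1 hr)

/-- For a cocycle `z` of `Gr^p` (`z ∈ F^p`, `d₁ z ∈ F^{p+1}`), its leading component `π₁ p z` is
`∂̄`-closed: `π₂ p (d₁ (π₁ p z)) = π₂ p (d₁ z) = 0`. [cite: VoisinHodgeI2002, §8.3.3] -/
theorem π₁_mem_pureClosed {p : ℕ} (hp : p ≤ B.N) {z : A₁}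
    (hz : z ∈ B.toFilteredTriple.grCocycles p) : B.π₁ p z ∈ B.pureClosed p := by
  rw [FilteredTriple.mem_grCocycles] at hz
  obtain ⟨hz₁, hz₂⟩ := hz
  refine ⟨B.π₁_π₁_self p z, ?_⟩
  have h : B.π₂ p (B.d₁ z) = B.π₂ p (B.d₁ (B.π₁ p z)) := by
    conv_lhs => rw [← B.sum_π₁ z]
    rw [map_sum, map_sum]
    refine Finset.sum_eq_single p (fun r _ hr ↦ ?_) (fun h ↦ absurd (Finset.mem_range.2 (Nat.lt_succ_of_le hp)) h)
    rcases lt_or_gt_of_ne hr with hr | hr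
    · rw [hz₁ r hr, map_zero, map_zero]
    · exact B.π₂_d₁_π₁ (Nat.ne_of_lt hr) (by omega) z
  rw [← h]
  exact hz₂ p (Nat.lt_succ_self p)

/-- The comparison map `H(Gr^p) ∋ [z] ↦ [π₁ p z] ∈ pureCohomology p` on cocycles.
[cite: VoisinHodgeI2002, §8.3.3] -/
def grCocyclesToPure {p : ℕ} (hp : p ≤ B.N) :
    ↥(B.toFilteredTriple.grCocycles p) →ₗ[K] B.pureCohomology p :=
  ((B.pureExact p).comap (B.pureClosed p).subtype).mkQ ∘ₗ
    LinearMap.codRestrict (B.pureClosed p) (B.π₁ p ∘ₗ (B.toFilteredTriple.grCocycles p).subtype)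
      fun z ↦ B.π₁_mem_pureClosed hp z.2

/-- A cocycle of `Gr^p` whose leading component is `∂̄`-exact is a coboundary of `Gr^p`:
if `π₁ p z = π₁ p (d₀ y)` with `y` of pure type `p`, then `z = d₀ y + (z - d₀ y)` with
`y ∈ F^p` and `z - d₀ y ∈ F^{p+1}`. [cite: VoisinHodgeI2002, §8.3.3] -/
theorem mem_grCoboundaries_of_grCocyclesToPure_eq_zero {p : ℕ} (hp : p ≤ B.N)
    (z : ↥(B.toFilteredTriple.grCocycles p)) (hz : B.grCocyclesToPure hp z = 0) :
    (z : A₁) ∈ B.toFilteredTriple.grCoboundaries p := by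
  rw [grCocyclesToPure, LinearMap.comp_apply, Submodule.mkQ_apply, Submodule.Quotient.mk_eq_zero,
    Submodule.mem_comap, Submodule.subtype_apply, LinearMap.codRestrict_apply,
    LinearMap.comp_apply, Submodule.subtype_apply, mem_pureExact] at hz
  obtain ⟨y, hy⟩ := hz
  have hz₁ := ((FilteredTriple.mem_grCocycles _).1 z.2).1
  rw [FilteredTriple.grCoboundaries, Submodule.mem_sup]
  refine ⟨B.d₀ (B.π₀ p y), Submodule.mem_map_of_mem fun r hr ↦ B.π₀_π₀_of_ne (Nat.ne_of_lt hr) y,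
    (z : A₁) - B.d₀ (B.π₀ p y), fun r hr ↦ ?_, add_sub_cancel _ _⟩
  rw [map_sub]
  rcases Nat.lt_succ_iff_lt_or_eq.1 hr with hr | rfl
  · rw [hz₁ r hr, B.π₁_d₀_π₀ (Nat.ne_of_lt hr) (by omega) y, sub_zero]
  · rw [hy, sub_self]

/-- `H(Gr^p)` is a quotient of a subspace of the `∂̄`-cohomology in pure type `p` (the
leading-component map on cocycles kills only coboundaries); in particular, if
`pureCohomology p` is finite-dimensional then so is `H(Gr^p)`, of at most the same dimension
("`E_∞^{p,q}` can be identified with a quotient of a subspace of `E_1^{p,q}`", Voisin (2002),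
p. 205). [cite: VoisinHodgeI2002, §8.3.3, Rem. 8.27] -/
theorem finite_and_finrank_grCohomology_le {p : ℕ} (hp : p ≤ B.N)
    (h : FiniteDimensional K (B.pureCohomology p)) :
    FiniteDimensional K (B.toFilteredTriple.grCohomology p) ∧
      finrank K (B.toFilteredTriple.grCohomology p) ≤ finrank K (B.pureCohomology p) :=
  haveI := h
  finite_and_finrank_subquotient_le _ _ (B.grCocyclesToPure hp)
    (B.mem_grCoboundaries_of_grCocyclesToPure_eq_zero hp)

/-- **Frölicher inequality, algebraic form.** For a bigraded triple whose `∂̄`-cohomologies in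
pure types `p ≤ N` are finite-dimensional, the cohomology `H = ker d₁ / im d₀` of the middle
degree is finite-dimensional and `dim H ≤ ∑_{p=0}^{N} dim (pureCohomology p)`; for the de Rham
complex of a compact complex manifold this reads `dim H^k_dR(M; ℂ) ≤ ∑_{p+q=k} h^{p,q}(M)`
(Voisin (2002), §8.3.3, proof of Thm. 8.28 and Rem. 8.29, pp. 204–205; Frölicher (1955), §2).
[cite: VoisinHodgeI2002, §8.3.3, proof of Thm. 8.28 and Rem. 8.29] -/
theorem finite_and_finrank_cohomology_le_sum
    (hfin : ∀ p ≤ B.N, FiniteDimensional K (B.pureCohomology p)) :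
    FiniteDimensional K B.cohomology ∧
      finrank K B.cohomology ≤ ∑ p ∈ range (B.N + 1), finrank K (B.pureCohomology p) := by
  obtain ⟨h1, h2⟩ := B.toFilteredTriple.finite_and_finrank_cohomology_le B.N B.F₁_succ_N_eq_bot
    fun p hp ↦ (B.finite_and_finrank_grCohomology_le hp (hfin p hp)).1
  refine ⟨h1, h2.trans (Finset.sum_le_sum fun p hp ↦ ?_)⟩
  have hp' : p ≤ B.N := Nat.lt_succ_iff.1 (Finset.mem_range.1 hp)
  exact (B.finite_and_finrank_grCohomology_le hp' (hfin p hp')).2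

/-- **Frölicher inequality, algebraic form** (target family version): if each `∂̄`-cohomology in
pure type `p ≤ N` is identified with a finite-dimensional space `H p` (in applications: the
Dolbeault group `H^{p,k-p}_{∂̄}`), then `H = ker d₁ / im d₀` is finite-dimensional and
`dim H ≤ ∑_{p=0}^{N} dim (H p)`. [cite: VoisinHodgeI2002, §8.3.3, proof of Thm. 8.28 and Rem. 8.29] -/
theorem finite_and_finrank_cohomology_le_sum_of_equiv {H : ℕ → Type w}
    [∀ p, AddCommGroup (H p)] [∀ p, Module K (H p)]
    (hfin : ∀ p ≤ B.N, FiniteDimensional K (H p))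
    (he : ∀ p ≤ B.N, Nonempty (B.pureCohomology p ≃ₗ[K] H p)) :
    FiniteDimensional K B.cohomology ∧
      finrank K B.cohomology ≤ ∑ p ∈ range (B.N + 1), finrank K (H p) := by
  have hfin' : ∀ p ≤ B.N, FiniteDimensional K (B.pureCohomology p) := fun p hp ↦
    haveI := hfin p hp
    LinearEquiv.finiteDimensional (he p hp).some.symm
  obtain ⟨h1, h2⟩ := B.finite_and_finrank_cohomology_le_sum hfin'
  refine ⟨h1, h2.trans (le_of_eq (Finset.sum_congr rfl fun p hp ↦ ?_))⟩
  exact LinearEquiv.finrank_eq (he p (Nat.lt_succ_iff.1 (Finset.mem_range.1 hp))).some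

end BigradedTriple

end Literature.Algebra.Homology
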